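import Summits.AtomisticToContinuum.Crystallization.Theorems.ExcessDecayLiouvilleDefs
import Summits.AtomisticToContinuum.Crystallization.Theorems.ExcessDecayLiouvilleChainDefs

/-!
# Route `ExcessDecayLiouville`: the invariant of the excess-decay chain (definition)

Harmonic-replacement architecture for item `ExcessDecay` (stmt-AtomisticToContinuum-9334), nonlinear half.
`ChainInv … σ γ U Vb aff a B` is the state of the chain of harmonic replacements about the centre `c₀` at the
scale `ρ = σ²` with mass constant `C = γ²`:

* `aff` is affine-plus-shift with data `(a, B)` about `c₀` and has no self-force (relaxed);
* MASSES: `𝐌[χ·((π − id) − aff), X] ≤ 32 γ² X⁶` for `max(1, σ²) ≤ X ≤ r/4` (radial site cut-off `χ` of `B_r(c)`,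
  `= 1` on `B_{r/2}(c)`, width `r/4`);
* BUDGETS: the slope, the sublattice jump and the displacement of `aff` from the initial approximant `aff₀` are
  controlled by the accumulated slope-type sum `U` and value-type sum `Vb` of the steps made so far;
* POTENTIALS (history-free geometric sums): `U + 2γσ + 2σ²(Φ + ν) ≤ U⋆ + 2ϑ·Du/(σr²)` and
  `Vb + 2·vAgg σ γ Φ Du r ≤ V⋆` with `ϑ = 1/(4L¹⁰)`;
* RANGE: `L¹⁷ ≤ σ ≤ σ₀`, `γ₀ ≤ γ`.

A route-internal predicate with parameters (bookkeeping of the induction over scales); `[folklore]`.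
Nothing here closes an item.
-/

noncomputable section

namespace Summit.AtomisticToContinuum.Crystallization.Theorems.ExcessDecayLiouville

open scoped BigOperators Topology InnerProductSpace RealInnerProductSpace Classical
open Summit.AtomisticToContinuum.Crystallization.Theorems.PhononStabilityNegative

/-- **The invariant of the excess-decay chain** at scale `σ` (`ρ = σ²`) with root mass constant `γ` (`C = γ²`),
accumulated slope-type budget `U` and value-type budget `Vb`, for the approximant `aff` with data `(a, B)` about
`c₀` (see the module docstring; `χ` is the radial site cut-off of `B_r(c)` of width `r/4`). [folklore] -/
def ChainInv (t : Fin 2 → EuclideanSpace ℝ (Fin 3)) (A : EuclideanSpace ℝ (Fin 3) →L[ℝ] EuclideanSpace ℝ (Fin 3))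
    (π : EuclideanSpace ℝ (Fin 3) → EuclideanSpace ℝ (Fin 3)) (c : EuclideanSpace ℝ (Fin 3)) (r : ℝ)
    (c₀ : EuclideanSpace ℝ (Fin 3)) (aff₀ : EuclideanSpace ℝ (Fin 3) → EuclideanSpace ℝ (Fin 3))
    (L Φ ν Du Ustar Vstar b₀ j₀ σ₀ γ₀ σ γ U Vb : ℝ)
    (aff : EuclideanSpace ℝ (Fin 3) → EuclideanSpace ℝ (Fin 3)) (a : Fin 2 → EuclideanSpace ℝ (Fin 3))
    (B : EuclideanSpace ℝ (Fin 3) →L[ℝ] EuclideanSpace ℝ (Fin 3)) : Prop :=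
  (∀ (m : Fin 2) (z : EuclideanSpace ℝ (Fin 3)), z ∈ Λ₀ → aff (t m + A z) = a m + B (t m + A z - c₀)) ∧
  (∀ s : Sites₀ t A, (∑' q : Sites₀ t A,
      (if (s : EuclideanSpace ℝ (Fin 3)) ≠ q then
        ((-((‖((s : EuclideanSpace ℝ (Fin 3)) - q) + (aff s - aff q)‖ ^ 2)⁻¹) ^ 7 +
            ((‖((s : EuclideanSpace ℝ (Fin 3)) - q) + (aff s - aff q)‖ ^ 2)⁻¹) ^ 4) •
          (((s : EuclideanSpace ℝ (Fin 3)) - q) + (aff s - aff q))) else 0)) = 0) ∧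
  (∀ Xr : ℝ, 1 ≤ Xr → σ ^ 2 ≤ Xr → Xr ≤ r / 4 →
    (∑' p : Sites₀ t A,
      ‖(fun x : EuclideanSpace ℝ (Fin 3) =>
          (if x ∈ Sites₀ t A then max (min 1 ((r / 2 + r / 4 - dist x c) / (r / 4))) 0 else 0) • ((π x - x) - aff x))
          (p : EuclideanSpace ℝ (Fin 3))‖ ^ 2 *
        (if dist (p : EuclideanSpace ℝ (Fin 3)) c₀ ≤ Xr then (1 : ℝ) else 0)) ≤ 32 * γ ^ 2 * Xr ^ 6) ∧
  ‖B‖ ≤ b₀ + 12 * L ^ 8 * U ∧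
  ‖a 0 - a 1‖ ≤ j₀ + 2 * L ^ 13 * U ∧
  (∀ x ∈ Sites₀ t A, ‖aff x - aff₀ x‖ ≤ L ^ 8 * Vb + (L ^ 13 + 14 * L ^ 8 + 12 * L ^ 8 * (dist x c₀ + 11 / 10)) * U) ∧
  0 ≤ U ∧ 0 ≤ Vb ∧
  U + 2 * (γ * σ) + 2 * (σ ^ 2 * (Φ + ν)) ≤ Ustar + 2 * (1 / (4 * L ^ 10)) * (Du / (σ * r ^ 2)) ∧
  Vb + 2 * vAgg σ γ Φ Du r ≤ Vstar ∧
  L ^ 17 ≤ σ ∧ σ ≤ σ₀ ∧ γ₀ ≤ γ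

end Summit.AtomisticToContinuum.Crystallization.Theorems.ExcessDecayLiouville

end
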